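import Summits.NavierStokesRegularity.NavierStokesRegularity.Theses.MarginalReynoldsCreep
import HarnessLib

/-!
# `MarginalReynoldsCreep.NoBreathingSplitGlue` (item stmt-NavierStokesRegularity-17688, support): the typed
# decomposition `AmplificationHorizon → NoLateRelaxation → NoBreathing` of crux `NoBreathing`
# (stmt-13639), LANDED as a Theorems file (adapted verbatim from the crux-strategist workfile
# `Cruxes/NoBreathing/Split.lean`, with the two pieces now the ROUTE's declarations)

Crux-strategist BC2-redirect workfile.  `NoBreathing` says: for a maximal finite-energy classical
solution from Clay data which is NOT Type I (`limsup_{t↑T} R(t) = ∞`,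
`R(t) := (T - t) sup_x |u(t,x)|²`), the running coupling tends to infinity
(`liminf R = ∞`): it cannot RETURN to a Type-I level `M` infinitely often ("breathing").

A breather alternates DIPS (`R ≤ M`) and SPIKES of unbounded height.  Measured in similarity
time `s = -log(T - t)`, two disjoint mechanisms can produce it, and the crux splits along them:

* **X₁ = `AmplificationHorizon`** (pulse exclusion / the horizon does not degenerate).  There is
  ONE similarity horizon `τ₀ > 0` such that for EVERY level `M`, from every late Type-I(M) slice
  `t₀` (`∀ x, (T-t₀)|u(t₀,x)|² ≤ M`) the coupling stays bounded, `(T-t)|u(t,x)|² ≤ G(M)`, for all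
  `t ≥ t₀` with `T - t ≥ e^{-τ₀}(T - t₀)`.  Leray's local theory (1934, §19; Ożański–Pooley 2018
  Thm 6.22) gives this with the LEVEL-DEPENDENT horizon `θ(M) ≈ cν/M → 0`; iterating Leray only
  reaches the finite horizon `Σ θ(4^j M) < ∞`.  X₁ asks that the horizon be uniform in the level:
  tall spikes need long run-ups.  Failure mode: tall thin pulses erupting from a Type-I background
  within bounded log-time ("pulse breather").
* **X₂ = `NoLateRelaxation`** (irreversibility of sustained super-Type-I episodes).  For every
  level `M` there is a log-length `L(M)` such that, late enough, once the coupling has stayed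
  above `M` (no Type-I(M) slice) throughout a similarity interval of length `L`, it never returns
  to level `M`.  Failure mode: repeated aborted Type-II attempts — long active episodes relaxing
  back to Type-I(M) ("quiescent breather").

## The assembly (`noBreathing_of_amplificationHorizon_of_noLateRelaxation`, proved below)

(1) INDUCTION ON WINDOWS: from X₁, by concatenating `n` windows (the end slice of a window of
level `M` is a Type-I(G) slice, restart there at level `max(G,1)`), late Type-I(M) slices are
followed by bounded coupling `≤ G_n(M)` over the similarity horizon `n τ₀`, for every `n`.
(2) COVERING: suppose `u` breathes: Type-I(M) slices recur (negation of the conclusion) and, `u`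
not being Type I, spikes `(T-t₁)|u(t₁,x₁)|² > H` recur for every `H`.  Take `L = L(M)` from X₂,
`n` with `n τ₀ ≥ L`, `H > G_n(M)`.  A late spike `t₁` of height `> H` has NO Type-I(M) slice in
its run-up window `(T - e^{L}(T-t₁), t₁]` (by (1) such a slice would cap the spike at `G_n`), so
by X₂ no Type-I(M) slice ever follows `t₁` — contradicting recurrence.  About 200 lines of
filter/real bookkeeping; no PDE input is used in the seam, by design: the PDE content sits in the
two pieces.

## Exactness (certificates below)

`NoBreathing → X₁` and `NoBreathing → X₂` (both short): the split is a PARTITION of the breathing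
scenario (pulse-type vs quiescent-type), `NoBreathing ⟺ X₁ ∧ X₂`; neither piece alone gives
`NoBreathing` (an R-profile with log-dense dips and squeezed tall pulses satisfies X₂ and violates
X₁; one with sparser and sparser dips and slow build-ups satisfies X₁ and violates X₂), and
neither says anything about Type-I blow-up or about non-breathing Type-II blow-up, so neither
approaches the summit.
-/

noncomputable section

set_option linter.dupNamespace false

namespace Summit.NavierStokesRegularity.NavierStokesRegularity.Theorems.NoBreathingSplit

open MeasureTheory Set Function Filter Topology
open Literature.Analysis.FluidPDE
open scoped ENNReal NNReal

open Summit.NavierStokesRegularity.NavierStokesRegularity.Theses.MarginalReynoldsCreep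
  (AmplificationHorizon NoLateRelaxation NoBreathing)

/-! ### Filter bookkeeping near the blow-up time -/

/-- `∀ᶠ t in 𝓝[<] T, P t` unfolded: `P` holds on some `(a, T)`, `a < T`. [folklore] -/
theorem eventually_nhdsLT_iff {T : ℝ} {P : ℝ → Prop} :
    (∀ᶠ t in 𝓝[<] T, P t) ↔ ∃ a < T, ∀ t, a < t → t < T → P t := by
  rw [(nhdsLT_basis T).eventually_iff]
  constructor
  · rintro ⟨a, ha, h⟩
    exact ⟨a, ha, fun t h1 h2 => h ⟨h1, h2⟩⟩
  · rintro ⟨a, ha, h⟩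
    exact ⟨a, ha, fun t ht => h t ht.1 ht.2⟩

/-- `∃ᶠ t in 𝓝[<] T, P t` unfolded: every `(a, T)`, `a < T`, contains a point where `P` holds. [folklore] -/
theorem frequently_nhdsLT_iff {T : ℝ} {P : ℝ → Prop} :
    (∃ᶠ t in 𝓝[<] T, P t) ↔ ∀ a < T, ∃ t, a < t ∧ t < T ∧ P t := by
  rw [(nhdsLT_basis T).frequently_iff]
  constructor
  · intro h a ha
    obtain ⟨t, ht, hP⟩ := h a ha
    exact ⟨t, ht.1, ht.2, hP⟩
  · intro h a ha
    obtain ⟨t, h1, h2, hP⟩ := h a ha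
    exact ⟨t, ⟨h1, h2⟩, hP⟩

/-- Not Type I ⇒ spikes of every height recur: for every `H > 0` and `a < T` there are
`t ∈ (a, T)` and `x` with `(T - t)|u(t,x)|² > H`. -/
theorem spikes_of_not_isTypeIBlowup {u : ℝ → (EuclideanSpace ℝ (Fin 3)) → (EuclideanSpace ℝ (Fin 3))} {T : ℝ}
    (hnI : ¬ IsTypeIBlowup u T) {H : ℝ} (hH : 0 < H) :
    ∀ a < T, ∃ t, a < t ∧ t < T ∧ ∃ x, H < (T - t) * ‖u t x‖ ^ 2 := by
  intro a ha
  have hnot : ¬ ∀ᶠ t in 𝓝[<] T, ∀ x, ‖u t x‖ ≤ Real.sqrt H / Real.sqrt (T - t) :=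
    fun hev => hnI ⟨Real.sqrt H, hev⟩
  have hfr : ∃ᶠ t in 𝓝[<] T, ∃ x, Real.sqrt H / Real.sqrt (T - t) < ‖u t x‖ := by
    have h1 := Filter.not_eventually.1 hnot
    exact h1.mono fun t ht => by push Not at ht; exact ht
  obtain ⟨t, h1, h2, x, hx⟩ := frequently_nhdsLT_iff.1 hfr a ha
  refine ⟨t, h1, h2, x, ?_⟩
  have hTt : 0 < T - t := sub_pos.2 h2
  have hnn : 0 ≤ Real.sqrt H / Real.sqrt (T - t) := by positivity
  have hsq : (Real.sqrt H / Real.sqrt (T - t)) ^ 2 < ‖u t x‖ ^ 2 :=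
    pow_lt_pow_left₀ hx hnn two_ne_zero
  have hsq' : (Real.sqrt H / Real.sqrt (T - t)) ^ 2 = H / (T - t) := by
    rw [div_pow, Real.sq_sqrt hH.le, Real.sq_sqrt hTt.le]
  rw [hsq', div_lt_iff₀ hTt] at hsq
  linarith

/-! ### Step 1 — concatenating windows: horizon `n τ₀` for every `n` -/

/-- From a uniform horizon `τ₀` at every level, late Type-I(M) slices are followed by bounded
coupling over the horizon `n τ₀`, for every `n : ℕ` (restart at the end slice of each window at
level `max(G,1)`). -/
theorem horizon_iterate {u : ℝ → (EuclideanSpace ℝ (Fin 3)) → (EuclideanSpace ℝ (Fin 3))} {T τ₀ : ℝ} (hτ₀ : 0 < τ₀)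
    (hor : ∀ M : ℝ, 0 < M → ∃ G : ℝ, ∀ᶠ t₀ in 𝓝[<] T,
      (∀ x, (T - t₀) * ‖u t₀ x‖ ^ 2 ≤ M) →
        ∀ t : ℝ, t₀ ≤ t → Real.exp (-τ₀) * (T - t₀) ≤ T - t → ∀ x, (T - t) * ‖u t x‖ ^ 2 ≤ G) :
    ∀ n : ℕ, ∀ M : ℝ, 0 < M → ∃ G : ℝ, ∃ a < T, ∀ t₀, a < t₀ → t₀ < T →
      (∀ x, (T - t₀) * ‖u t₀ x‖ ^ 2 ≤ M) →
        ∀ t : ℝ, t₀ ≤ t → Real.exp (-(n * τ₀)) * (T - t₀) ≤ T - t →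
          ∀ x, (T - t) * ‖u t x‖ ^ 2 ≤ G := by
  intro n
  induction n with
  | zero =>
    intro M hM
    refine ⟨M, T - 1, by linarith, ?_⟩
    intro t₀ _ ht₀T hdip t ht₀t hwin x
    have hw : T - t₀ ≤ T - t := by simpa using hwin
    have htt₀ : t = t₀ := le_antisymm (by linarith) ht₀t
    rw [htt₀]
    exact hdip x
  | succ n ih =>
    intro M hM
    obtain ⟨G₁, a₁, ha₁, h1⟩ := ih M hM
    have hG₁' : 0 < max G₁ 1 := lt_max_of_lt_right one_pos
    obtain ⟨G₂, hG₂⟩ := hor (max G₁ 1) hG₁'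
    obtain ⟨a₂, ha₂, h2⟩ := eventually_nhdsLT_iff.1 hG₂
    refine ⟨max (max G₁ 1) G₂, max a₁ a₂, max_lt ha₁ ha₂, ?_⟩
    intro t₀ hat₀ ht₀T hdip t ht₀t hwin x
    have ha₁t₀ : a₁ < t₀ := lt_of_le_of_lt (le_max_left _ _) hat₀
    have ha₂t₀ : a₂ < t₀ := lt_of_le_of_lt (le_max_right _ _) hat₀
    by_cases hcase : Real.exp (-(n * τ₀)) * (T - t₀) ≤ T - t
    · exact (h1 t₀ ha₁t₀ ht₀T hdip t ht₀t hcase x).trans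
        ((le_max_left _ _).trans (le_max_left _ _))
    · push Not at hcase
      -- the intermediate slice `t₁ := T - e^{-n τ₀}(T - t₀)` is Type-I(max G₁ 1)
      set t₁ : ℝ := T - Real.exp (-(n * τ₀)) * (T - t₀) with ht₁
      have hTt₀ : 0 < T - t₀ := sub_pos.2 ht₀T
      have hexp_pos : 0 < Real.exp (-(n * τ₀)) := Real.exp_pos _
      have hexp_le : Real.exp (-(n * τ₀)) ≤ 1 := by
        rw [Real.exp_le_one_iff, neg_nonpos]
        positivity
      have hTt₁ : T - t₁ = Real.exp (-(n * τ₀)) * (T - t₀) := by rw [ht₁]; ring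
      have ht₀t₁ : t₀ ≤ t₁ := by
        have : Real.exp (-(n * τ₀)) * (T - t₀) ≤ T - t₀ := mul_le_of_le_one_left hTt₀.le hexp_le
        linarith
      have ht₁T : t₁ < T := by
        have : 0 < Real.exp (-(n * τ₀)) * (T - t₀) := mul_pos hexp_pos hTt₀
        linarith
      have hdip₁ : ∀ y, (T - t₁) * ‖u t₁ y‖ ^ 2 ≤ max G₁ 1 := fun y =>
        (h1 t₀ ha₁t₀ ht₀T hdip t₁ ht₀t₁ (le_of_eq hTt₁.symm) y).trans (le_max_left _ _)
      have ha₂t₁ : a₂ < t₁ := lt_of_lt_of_le ha₂t₀ ht₀t₁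
      have ht₁t : t₁ ≤ t := by linarith
      have hwin' : Real.exp (-τ₀) * (T - t₁) ≤ T - t := by
        rw [hTt₁, ← mul_assoc, ← Real.exp_add]
        have : -τ₀ + -(↑n * τ₀) = -(↑(n + 1) * τ₀) := by push_cast; ring
        rw [this]
        exact hwin
      exact (h2 t₁ ha₂t₁ ht₁T hdip₁ t ht₁t hwin' x).trans (le_max_right _ _)

/-! ### Step 2 — the covering argument: the assembly -/

/-- **The assembly `X₁ → X₂ → NoBreathing`** (the glue of the split; see the module docstring). -/
theorem noBreathing_of_amplificationHorizon_of_noLateRelaxation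
    (h₁ : AmplificationHorizon) (h₂ : NoLateRelaxation) :
    Summit.NavierStokesRegularity.NavierStokesRegularity.Theses.MarginalReynoldsCreep.NoBreathing := by
  intro ν T hν hT u p hmax hLH hdec hnI M₀
  obtain ⟨τ₀, hτ₀, hor⟩ := h₁ ν T hν hT u p hmax hLH hdec hnI
  have hrel := h₂ ν T hν hT u p hmax hLH hdec hnI
  have step := horizon_iterate hτ₀ hor
  by_contra hcon
  -- breathing: Type-I(M₀) slices recur
  have hfreq : ∃ᶠ t in 𝓝[<] T, ∀ x, (T - t) * ‖u t x‖ ^ 2 < M₀ := by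
    have h1 := Filter.not_eventually.1 hcon
    exact h1.mono fun t ht => by push Not at ht; exact ht
  set M : ℝ := max M₀ 1 with hMdef
  have hM : 0 < M := lt_max_of_lt_right one_pos
  have hdips : ∀ a < T, ∃ t, a < t ∧ t < T ∧ ∀ x, (T - t) * ‖u t x‖ ^ 2 ≤ M := by
    intro a ha
    obtain ⟨t, h1, h2, h3⟩ := frequently_nhdsLT_iff.1 hfreq a ha
    exact ⟨t, h1, h2, fun x => (h3 x).le.trans (le_max_left _ _)⟩
  -- X₂ at level M
  obtain ⟨L, hL, hrelM⟩ := hrel M hM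
  obtain ⟨a₂, ha₂, hR⟩ := eventually_nhdsLT_iff.1 hrelM
  -- horizon n τ₀ ≥ L from Step 1
  obtain ⟨n, hn⟩ : ∃ n : ℕ, L ≤ n * τ₀ := by
    obtain ⟨n, hn⟩ := Archimedean.arch L hτ₀
    exact ⟨n, by simpa [nsmul_eq_mul] using hn⟩
  obtain ⟨G, a₁, ha₁, hG⟩ := step n M hM
  set H : ℝ := max G 0 + 1 with hHdef
  have hH0 : 0 < H := by have := le_max_right G 0; linarith
  have hGH : G < H := by have := le_max_left G 0; linarith
  -- thresholds
  set a₀ : ℝ := max a₁ a₂ with ha₀def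
  have ha₀T : a₀ < T := max_lt ha₁ ha₂
  have heLpos : 0 < Real.exp (-L) := Real.exp_pos _
  have heL1 : Real.exp (-L) < 1 := by rw [Real.exp_lt_one_iff]; linarith
  have hee : Real.exp (-L) * Real.exp L = 1 := by rw [← Real.exp_add]; simp
  set a₃ : ℝ := T - Real.exp (-L) * (T - a₀) with ha₃def
  have ha₃T : a₃ < T := by
    have : 0 < Real.exp (-L) * (T - a₀) := mul_pos heLpos (sub_pos.2 ha₀T)
    linarith
  -- a late spike of height > H
  obtain ⟨t₁, hat₁, ht₁T, x₁, hx₁⟩ := spikes_of_not_isTypeIBlowup hnI hH0 a₃ ha₃T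
  have hTt₁ : 0 < T - t₁ := sub_pos.2 ht₁T
  -- the start of its run-up window of log-length L
  set s₁ : ℝ := T - Real.exp L * (T - t₁) with hs₁def
  have hTs₁ : T - s₁ = Real.exp L * (T - t₁) := by rw [hs₁def]; ring
  have hs₁t₁ : s₁ < t₁ := by
    have h1L : 1 < Real.exp L := Real.one_lt_exp_iff.2 hL
    have : T - t₁ < Real.exp L * (T - t₁) := lt_mul_of_one_lt_left hTt₁ h1L
    linarith
  have hs₁a₀ : a₀ < s₁ := by
    have h1 : T - t₁ < T - a₃ := by linarith
    have h2 : T - a₃ = Real.exp (-L) * (T - a₀) := by rw [ha₃def]; ring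
    have h3 : Real.exp L * (T - t₁) < Real.exp L * (Real.exp (-L) * (T - a₀)) := by
      rw [← h2]; exact mul_lt_mul_of_pos_left h1 (Real.exp_pos L)
    have h4 : Real.exp L * (Real.exp (-L) * (T - a₀)) = T - a₀ := by
      rw [← mul_assoc, mul_comm (Real.exp L), hee, one_mul]
    linarith
  have hs₁a₁ : a₁ < s₁ := lt_of_le_of_lt (le_max_left _ _) hs₁a₀
  have hs₁a₂ : a₂ < s₁ := lt_of_le_of_lt (le_max_right _ _) hs₁a₀
  have hs₁T : s₁ < T := hs₁t₁.trans ht₁T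
  -- the run-up window (s₁, t₁] contains no Type-I(M) slice (Step 1 would cap the spike at G < H)
  have hfree : ∀ r, s₁ < r → r ≤ t₁ → ∃ x, M < (T - r) * ‖u r x‖ ^ 2 := by
    intro r hsr hrt
    by_contra hno
    push Not at hno
    have har : a₁ < r := hs₁a₁.trans hsr
    have hrT : r < T := lt_of_le_of_lt hrt ht₁T
    have hTr : 0 < T - r := sub_pos.2 hrT
    have hwin : Real.exp (-(n * τ₀)) * (T - r) ≤ T - t₁ := by
      have h1 : Real.exp (-(n * τ₀)) ≤ Real.exp (-L) := Real.exp_le_exp.2 (by linarith)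
      have h2 : T - r < Real.exp L * (T - t₁) := by rw [← hTs₁]; linarith
      have h3 : Real.exp (-L) * (T - r) < T - t₁ := by
        calc Real.exp (-L) * (T - r) < Real.exp (-L) * (Real.exp L * (T - t₁)) :=
              mul_lt_mul_of_pos_left h2 heLpos
          _ = T - t₁ := by rw [← mul_assoc, hee, one_mul]
      calc Real.exp (-(n * τ₀)) * (T - r) ≤ Real.exp (-L) * (T - r) :=
            mul_le_mul_of_nonneg_right h1 hTr.le
        _ ≤ T - t₁ := h3.le
    have hcap := hG r har hrT hno t₁ hrt hwin x₁
    linarith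
  -- X₂: no Type-I(M) slice after t₁ ...
  have hwin₁ : T - t₁ ≤ Real.exp (-L) * (T - s₁) := by
    rw [hTs₁, ← mul_assoc, hee, one_mul]
  have hnodip : ∀ t', t₁ ≤ t' → t' < T → ∃ x, M < (T - t') * ‖u t' x‖ ^ 2 :=
    hR s₁ hs₁a₂ hs₁T t₁ hs₁t₁ ht₁T hwin₁ hfree
  -- ... but Type-I(M) slices recur
  obtain ⟨t', h1, h2, hdip'⟩ := hdips t₁ ht₁T
  obtain ⟨x, hx⟩ := hnodip t' h1.le h2
  exact absurd (hdip' x) (not_le.2 hx)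

/-! ### Exactness certificates: each piece is a consequence of the crux -/

/-- `NoBreathing → X₁`: under `NoBreathing` a non-Type-I solution has no late Type-I(M) slices,
so X₁ holds vacuously (with `τ₀ = 1`). -/
theorem amplificationHorizon_of_noBreathing
    (h : Summit.NavierStokesRegularity.NavierStokesRegularity.Theses.MarginalReynoldsCreep.NoBreathing) :
    AmplificationHorizon := by
  intro ν T hν hT u p hmax hLH hdec hnI
  refine ⟨1, one_pos, fun M hM => ⟨0, ?_⟩⟩
  have hev := h ν T hν hT u p hmax hLH hdec hnI (M + 1)
  filter_upwards [hev] with t₀ ht₀ hdip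
  obtain ⟨x, hx⟩ := ht₀
  have := hdip x
  exact absurd this (by linarith)

/-- `NoBreathing → X₂`: likewise vacuous (with `L = 1`): late slices are never Type-I(M). -/
theorem noLateRelaxation_of_noBreathing
    (h : Summit.NavierStokesRegularity.NavierStokesRegularity.Theses.MarginalReynoldsCreep.NoBreathing) :
    NoLateRelaxation := by
  intro ν T hν hT u p hmax hLH hdec hnI M hM
  refine ⟨1, one_pos, ?_⟩
  have hev := h ν T hν hT u p hmax hLH hdec hnI (M + 1)
  obtain ⟨a, ha, hA⟩ := eventually_nhdsLT_iff.1 hev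
  refine eventually_nhdsLT_iff.2 ⟨a, ha, ?_⟩
  intro s has hsT t hst htT _ _ t' htt' ht'T
  obtain ⟨x, hx⟩ := hA t' (by linarith) ht'T
  exact ⟨x, by linarith⟩

/-- The split is lossless: `NoBreathing ⟺ X₁ ∧ X₂` (recorded as two implications and the
assembly; NOT an equivalence of either piece with the crux). -/
theorem noBreathing_iff_pieces :
    Summit.NavierStokesRegularity.NavierStokesRegularity.Theses.MarginalReynoldsCreep.NoBreathing ↔
      (AmplificationHorizon ∧ NoLateRelaxation) :=
  ⟨fun h => ⟨amplificationHorizon_of_noBreathing h, noLateRelaxation_of_noBreathing h⟩,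
    fun h => noBreathing_of_amplificationHorizon_of_noLateRelaxation h.1 h.2⟩

/-- **Item stmt-NavierStokesRegularity-17688** (`MarginalReynoldsCreep.NoBreathingSplitGlue`): the
glue `AmplificationHorizon → NoLateRelaxation → NoBreathing`, literally the route decl. [this file] -/
theorem marginalReynoldsCreep_noBreathingSplitGlue_proof :
    Summit.NavierStokesRegularity.NavierStokesRegularity.Theses.MarginalReynoldsCreep.NoBreathingSplitGlue :=
  fun h₁ h₂ => noBreathing_of_amplificationHorizon_of_noLateRelaxation h₁ h₂

end Summit.NavierStokesRegularity.NavierStokesRegularity.Theorems.NoBreathingSplit
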